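import Literature.MathematicalPhysics.QuantumFieldTheory.Balaban1983to89.B13SiteReadingNumerals

/-!
# `Balaban1983to89.B13BlockBondReadingNumerals` — T. Bałaban, *Renormalization group approach to lattice gauge field theories. II. Cluster expansions*,
# Commun. Math. Phys. **116** (1988) 1–22 [Balaban1988RG2Cluster], (2.5)–(2.7) pp. 12–13, p. 15 (kernels localised at points of the unit torus, decay
# `e^{−δ d(x,x′)}`); *Propagators and renormalization transformations for lattice gauge theories. II*, Commun. Math. Phys. **96** (1984) 223–250
# [Balaban1984PropagatorsII], (2.1) p. 224 (the torus `T_η = Ω₁` as a box with periodic conditions), (2.14)–(2.17) p. 225 (`Q′`, `Q′*`), (2.45)–(2.46)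
# p. 231 (`𝔅`, the ℓ¹ contour distance); *Propagators for lattice gauge theories in a background field*, Commun. Math. Phys. **99** (1985) 389–434
# [Balaban1985BackgroundPropagators], (3.2)–(3.3) p. 390, (3.8) p. 392, (3.19) p. 393: ★ THE BLOCK AND BOND READINGS THAT GO WITH A SITE READING OF
# NODE 00's CARRIER INTO [13]'s UNIT TORUS, THEIR LOCATED NUMERALS, AND THE EXACT DICTIONARY `d₁(ℓ z, ℓ w) = |z − w|₁`.

COMPANION of dag-n10-w6's `B13SiteReadingNumerals` (the SITE reading `fineReadingY` of NODE 00's box sites by their labels, with 79's numerals `κ, s, D,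
C_avg, m`).  The N10 stations of the inverse road (w2's `B13OpsYPencilXQuadGen ∕ …RProj ∕ …Green`, module 76 `…DeltaALetters`) display, next to the site
reading `ℓS : SiteY i → UT Nf`, a BLOCK reading `ℓB : BlkY i → UT Nf` (the `X = Q′G′²Q′*` sector lives on `𝔅`) and a FINE-BOND reading
`ℓF : FBondY i → UT Nf` (the `D_U ∕ D*_U ∕ Δ_U` sector lives on bonds), with fibre bounds `hfibB hfibF` and range numerals (`hℓQ hℓQs`: `Q′(s,z) ≠ 0 ⇒
d₁(ℓB s, ℓS z) ≤ r`; `hℓG hℓD`: `∂(b,z) ≠ 0 ⇒ d₁(ℓF b, ℓS z) ≤ r′`; `hℓp`: plaquette diameter).  THIS FILE builds both readings FROM ANY site reading `ℓ`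
that is faithful to the labels (`hval : val (ℓ z)_μ = z_μ`; dag-n10-w6's `fineReadingY` is the instance of record for this file) — a block of `𝔅` is read AT
ITS CORNER (`blkCornerY`), a fine bond AT ITS SOURCE `b₋` — and proves every one of those numerals as a NUMBER: `hfibB ≤ card κ`, `hfibF ≤ (d+1)·card κ`,
`hℓQ ∕ hℓQs` with `r = (d+1)(L^k − 1)` (the corner leg inside one `L^{lev}`-block), `hℓG ∕ hℓD` with `r′ = 1`, `hℓp` with `2`.  §1 is the EXACT DICTIONARY
behind all of it: for a label-faithful reading `d₁(ℓ z, ℓ w) = Σ_μ dist(z_μ − w_μ, N_μℤ) = |chart⁻¹ z − chart⁻¹ w|₁` (pv27's chart `boxEquiv i.hN`, the ℓ¹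
torus STEP distance `Site.tdist` of `T^{(0)}`) and `|z − w|_T ≤ d₁` (the lower comparison; the upper `d₁ ≤ (d+1)|z − w|_T` is dag-n10-w6's).

[folklore] lattice-torus bookkeeping (`ZMod.val`, `circAbs`, integer division) over NODE 00's `rfl`-level kernels (`qpK ∕ qpsK = Q′ ∕ Q′*` block
indicators, `gradK` stencil, `edgeY`); kernel-checked; TWO SMALL DEFINITIONS (`bondReadingOf`, `blkReadingOf` — readings only: no operator, no carrier,
no instance, no notation); NOTHING of NODE 00's ∕ pv27's ∕ dag-n10-w6's is modified; nothing here is a claim about the Yang–Mills mass gap; no node is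
discharged; count-neutral.

WHY THIS FILE (cell `pub-ymgap`, HUMAN RULING D-0062 ∕ D-0149, Track A node N10 = [B13]; WIDTH SEAT `pub-ymgap-dag-n10-w4` g4, CLAIM-2 = items X1 + X2
worded by dag-n10-w6 g3 («n10-w4 take X1 + X2») under dag-lead DEDUP-386 (1); lane owner dag-n10-c's RESIDUAL CENSUS v17 «What would move N10 next»
ITEM 4, block∕bond half).  WHETHER the N10 term of record reads its sites ∕ blocks ∕ bonds this way is NODE 00's ∕ def-T's word (census item 3) — NOT
claimed here; these are LOCATED INSTANCES showing the stations' reading binders jointly inhabited with explicit numbers.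

WHAT THIS FILE PROVES (all `theorem`s unless marked `def`; `ℓ : SiteY i → UT Nf` any site reading, `hval` = label-faithful, `hNf : N₀ = Nf`).
* §1 THE DICTIONARY: `tdist1_eq_sum_circAbs_of_val` (`d₁(ℓ z, ℓ w) = Σ_μ dist(z_μ − w_μ, Nf_μ ℤ)`), ★ `tdist1_eq_tdist_chart_of_val` (`= |chart⁻¹ z − chart⁻¹ w|₁`,
  cast EQUALITY), ★ `torusSupNorm_le_tdist1_of_val` (`|z − w|_T ≤ d₁`); Site-level [folklore]: `tdist_le_of_div_eq` (same `⌊·∕s⌋`-labels ⇒ `≤ P.d·(s−1)`).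
* §2 THE BLOCK READING `def blkReadingOf ℓ : BlkY i → UT Nf` (at the corner): `blkReadingOf_injective`, ★ `card_fibre_blkReadingOf_le` (`hfibB ≤ card κ`),
  `blk_blkCornerY_eq`, `tdist_chart_blkCornerY_le_of_blkOf_eq` (`|chart⁻¹(corner s) − chart⁻¹ z|₁ ≤ (d+1)(L^k − 1)` for `z ∈ s`), ★ `tdist1_blkReadingOf_le_of_blkOf_eq`,
  ★★ `hℓQ_blkReadingOf` ∕ `hℓQs_blkReadingOf` (XQuadGen ∕ RProj's range binders with `r = (d+1)(L^k − 1)`).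
* §3 THE BOND READING `def bondReadingOf ℓ : FBondY i → UT Nf` (at `b₋`): ★ `card_fibre_bondReadingOf_le` (`hfibF ≤ (d+1)·card κ`), `tdist1_bondReadingOf_src`
  (`= 0`), `tdist1_bondReadingOf_tgt_le_one`, ★★ `hℓG_bondReadingOf` ∕ `hℓD_bondReadingOf` (Green's `D_U ∕ D*_U` range binders with `r′ = 1`), ★ `hℓp_bondReadingOf`
  (76's plaquette-diameter binder with `2`).
* §4 ★ AT dag-n10-w6's `fineReadingY` (p611691): `def blkReadingY ∕ bondReadingY` (the readings of record for these instances), `…_apply`, `blkReadingY_injective`,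
  `card_fibre_blkReadingY_le ∕ _bondReadingY_le` (+ `_matrixUnits`: `N·N`, `(d+1)·N·N`), ★ `tdist1_fineReadingY_eq_tdist_chart`, ★ `torusSupNorm_le_tdist1_fineReadingY`,
  `tdist1_blkReadingY_le_of_blkOf_eq`, ★★ `hℓQ_blkReadingY ∕ hℓQs_blkReadingY ∕ hℓG_bondReadingY ∕ hℓD_bondReadingY ∕ hℓp_bondReadingY`, `tdist1_bondReadingY_src ∕ _tgt_le_one`.
HONEST FRAMING: located instances + [folklore] arithmetic; finite-lattice numbers at the coarsest scale (one fine step = torus distance `1`); nothing of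
Bałaban's asserted; N06 ∕ N10 NOT discharged; K1⁷ NOT closed; counts unmoved (typed 28∕28 · discharged 5∕27); 0 `sorry`, 0 instance, 0 notation,
standard axioms; one finite 𝕋⁴ programme at fixed ε — R4 closes the conditional finite-𝕋⁴ rung `BalabanLadder.UV` only; the YM mass gap (Clay) is NOT
proved by any of this; nothing continuum ∕ ℝ⁴ ∕ OS.

References: T. Bałaban, CMP 116 (1988) 1–22 [Balaban1988RG2Cluster] (2.5)–(2.7) pp.12–13, p.15; CMP 96 (1984) 223–250 [Balaban1984PropagatorsII] (2.1) p.224,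
(2.14)–(2.17) p.225, (2.45)–(2.46) p.231; CMP 99 (1985) 389–434 [Balaban1985BackgroundPropagators] (3.2)–(3.3) p.390, (3.8) p.392, (3.10) p.392, (3.19) p.393,
(3.107)–(3.108) p.416; CMP 109 (1987) 249–301 [Balaban1987RG1] (0.1) p.251 (site labels).
-/

noncomputable section

namespace Literature.MathematicalPhysics.QuantumFieldTheory.Balaban1983to89.B13BlockBondReadingNumerals

open Finset
open Literature.MathematicalPhysics.QuantumFieldTheory.Balaban1983to89
open Literature.MathematicalPhysics.QuantumFieldTheory.Balaban1983to89.B6KLevelCensusIndexV1 (KIdx)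
open Literature.MathematicalPhysics.QuantumFieldTheory.Balaban1983to89.B6GlobalChartV1 (PV boxEquiv val_boxEquiv_symm)
open Literature.MathematicalPhysics.QuantumFieldTheory.Balaban1983to89.B4Reflection242 (boxDom mem_boxDom blk)
open Literature.MathematicalPhysics.QuantumFieldTheory.Balaban1983to89.B4TorusKernel.MultiPeriod (torusSupNorm circAbs circAbs_nonneg circAbs_le_abs)
open Literature.MathematicalPhysics.QuantumFieldTheory.Balaban1983to89.B4Sect5Torus (TSite ccoord ccoord_cast)
open Literature.MathematicalPhysics.QuantumFieldTheory.Balaban1983to89.B6MultiLevelTorusOperator (one_le_of_mem)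
open Literature.MathematicalPhysics.QuantumFieldTheory.Balaban1983to89.B6Geom246MultiLevelBox (blkOf corner corner_mem blkOf_corner blkOf_eq_iff_blk)
open Literature.MathematicalPhysics.QuantumFieldTheory.Balaban1983to89.B6Ineq288MultiLevelTorus (QM QsM)
open Literature.MathematicalPhysics.QuantumFieldTheory.Balaban1983to89.B5TorusCover (UT)
open Literature.MathematicalPhysics.QuantumFieldTheory.Balaban1983to89.B9Thm37GlueTorus (tdist1 tdist1_self tdist1_comm tdist1_triangle)
open Literature.MathematicalPhysics.QuantumFieldTheory.Balaban1983to89.Node00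
  (SiteY FBondY BlkY toKT shiftY levY blkCornerY qpK qpsK gradK divK edgeY gradK_ne_zero_cases divK_eq_transpose)

/-! ## §0. Kernel arithmetic on `ℤ∕n` and on the sites of `T^{(j)}` ([folklore]) -/

section Kernel

/-- kernel: the circular distance of two residues, computed from their labels: `min (val(a−b), val(b−a)) = dist(val a − val b, nℤ)`. [folklore] -/
private theorem cast_min_val_sub_eq_circAbs {n : ℕ} [NeZero n] (a b : ZMod n) :
    ((min (a - b).val (b - a).val : ℕ) : ℤ) = circAbs n ((a.val : ℤ) - (b.val : ℤ)) := by
  have hab : a - b = (((a.val : ℤ) - (b.val : ℤ) : ℤ) : ZMod n) := by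
    rw [Int.cast_sub, Int.cast_natCast, Int.cast_natCast, ZMod.natCast_zmod_val, ZMod.natCast_zmod_val]
  have hv : (((a - b).val : ℕ) : ℤ) = ((a.val : ℤ) - (b.val : ℤ)) % (n : ℤ) := by
    rw [hab, ZMod.val_intCast]
  have hlt : (a - b).val < n := ZMod.val_lt _
  have hmin : (min (a - b).val (b - a).val : ℕ) = min (a - b).val (n - (a - b).val) := by
    rw [show b - a = -(a - b) from (neg_sub a b).symm, ZMod.neg_val]
    split_ifs with h
    · rw [h, ZMod.val_zero]; simp
    · rfl
  rw [hmin, Nat.cast_min, Nat.cast_sub hlt.le, hv]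
  rfl

/-- kernel: two naturals with the same quotient by `s ≥ 1` differ by at most `s − 1`. [folklore] -/
private theorem le_add_of_div_eq {s a b : ℕ} (hs : 0 < s) (h : a / s = b / s) : a ≤ b + (s - 1) := by
  have ha := Nat.div_add_mod a s
  have hb := Nat.div_add_mod b s
  have hma := Nat.mod_lt a hs
  have hmb := Nat.mod_lt b hs
  rw [h] at ha
  omega

/-- kernel: the circular distance of two residues is at most the distance of their labels. [folklore] -/
private theorem min_val_sub_le {n : ℕ} [NeZero n] (a b : ZMod n) {t : ℕ} (h1 : a.val ≤ b.val + t) (h2 : b.val ≤ a.val + t) :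
    min (a - b).val (b - a).val ≤ t := by
  rcases le_total b.val a.val with hle | hle
  · have := ZMod.val_sub hle
    have : (a - b).val ≤ t := by rw [this]; omega
    exact (min_le_left _ _).trans this
  · have := ZMod.val_sub hle
    have : (b - a).val ≤ t := by rw [this]; omega
    exact (min_le_right _ _).trans this

variable {P : Params}

/-- two sites whose labels have the same quotients by `s ≥ 1` in every direction (one cube of side `s`) are at most `P.d·(s − 1)` steps apart.
[cite: Balaban1984PropagatorsII, (2.1) p.224 (blocks of side `L^j`), bookkeeping] -/
theorem tdist_le_of_div_eq {j s : ℕ} (hs : 0 < s) {x y : Site P j} (h : ∀ μ, (x μ).val / s = (y μ).val / s) :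
    Site.tdist x y ≤ P.d * (s - 1) := by
  unfold Site.tdist
  calc ∑ μ : Fin P.d, min (x μ - y μ).val (y μ - x μ).val ≤ ∑ _μ : Fin P.d, (s - 1) :=
        Finset.sum_le_sum fun μ _ => min_val_sub_le (x μ) (y μ) (le_add_of_div_eq hs (h μ)) (le_add_of_div_eq hs (h μ).symm)
    _ = P.d * (s - 1) := by rw [Finset.sum_const, Finset.card_univ, Fintype.card_fin, smul_eq_mul]

/-- kernel: the ℓ¹ torus step distance is symmetric (public homonym: `B3Taylor310LocalRemainder.tdist_comm`, not imported to keep the closure light). [folklore] -/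
private theorem tdist_comm' {j : ℕ} (x y : Site P j) : Site.tdist x y = Site.tdist y x := by
  unfold Site.tdist
  exact Finset.sum_congr rfl fun μ _ => min_comm _ _

/-- kernel: one lattice step, `|x − (x + e_μ)|₁ ≤ 1` (homonyms on other site types: `B9Eq349BlockDistanceWeight.tdist_shift_le_one`, the Balaban3D summit's
`Run3Collar.tdist_shift_le`). [folklore] -/
private theorem tdist_shift_le_one {j : ℕ} (x : Site P j) (μ : Fin P.d) : Site.tdist x (x.shift μ) ≤ 1 := by
  unfold Site.tdist Site.shift
  have h1 : ∀ ν : Fin P.d, min (x ν - Function.update x μ (x μ + 1) ν).val (Function.update x μ (x μ + 1) ν - x ν).val ≤ if ν = μ then 1 else 0 := by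
    intro ν
    by_cases h : ν = μ
    · subst h
      simp only [Function.update_self, add_sub_cancel_left, if_true]
      refine (min_le_right _ _).trans ?_
      rw [show (1 : ZMod (P.sitesPerDir j)) = ((1 : ℕ) : ZMod (P.sitesPerDir j)) by rw [Nat.cast_one], ZMod.val_natCast]
      exact Nat.mod_le _ _
    · simp [h]
  calc ∑ ν : Fin P.d, min (x ν - Function.update x μ (x μ + 1) ν).val (Function.update x μ (x μ + 1) ν - x ν).val
      ≤ ∑ ν : Fin P.d, (if ν = μ then 1 else 0) := Finset.sum_le_sum fun ν _ => h1 ν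
    _ = 1 := by simp

end Kernel

/-! ## §1. The exact dictionary of a label-faithful site reading: `d₁(ℓ z, ℓ w) = |chart⁻¹ z − chart⁻¹ w|₁`, `|z − w|_T ≤ d₁` -/

section Dictionary

variable {d ℓ : ℕ} {hd : 1 ≤ d + 1} {hL : Odd (ℓ + 1) ∧ 1 < ℓ + 1} {b₀ b₁ : ℝ}
variable (i : KIdx d ℓ hd hL b₀ b₁)
variable {Nf : Fin (d + 1) → ℕ} [∀ μ, NeZero (Nf μ)] (ℓS : SiteY i → UT Nf)

/-- one coordinate through the chart: `min (val(x_μ − y_μ), val(y_μ − x_μ)) = dist(z_μ − w_μ, N₀_μℤ)` for the chart points `x, y` of `z, w`.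
[cite: Balaban1984PropagatorsII, (2.1) p.224, (2.46) p.231, bookkeeping] -/
theorem cast_min_val_chart_eq_circAbs (z w : SiteY i) (μ : Fin (d + 1)) :
    ((min (((boxEquiv i.hN).symm z) μ - ((boxEquiv i.hN).symm w) μ).val (((boxEquiv i.hN).symm w) μ - ((boxEquiv i.hN).symm z) μ).val : ℕ) : ℤ) =
      circAbs ((toKT i).NB μ) (z.1 μ - w.1 μ) := by
  rw [cast_min_val_sub_eq_circAbs, val_boxEquiv_symm, val_boxEquiv_symm]
  exact congrArg (fun n : ℕ => circAbs n (z.1 μ - w.1 μ)) (i.hN μ).symm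

/-- `d₁(ℓ z, ℓ w) = Σ_μ dist(z_μ − w_μ, Nf_μ ℤ)` for a LABEL-FAITHFUL reading (`val (ℓ z)_μ = z_μ`). [cite: Balaban1984PropagatorsII, (2.46) p.231; Balaban1988RG2Cluster, (2.5) p.12, dictionary] -/
theorem tdist1_eq_sum_circAbs_of_val (hval : ∀ (z : SiteY i) (μ : Fin (d + 1)), (((UT.toSite Nf (ℓS z)) μ).val : ℤ) = z.1 μ) (z w : SiteY i) :
    tdist1 Nf (ℓS z) (ℓS w) = ∑ μ, ((circAbs (Nf μ) (z.1 μ - w.1 μ) : ℤ) : ℝ) := by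
  unfold tdist1
  refine Finset.sum_congr rfl fun μ _ => ?_
  have h1 : ∀ ν, 1 ≤ Nf ν := fun ν => NeZero.one_le
  have h : ((ccoord Nf (UT.toSite Nf (ℓS z)) (UT.toSite Nf (ℓS w)) μ : ℕ) : ℤ) = circAbs (Nf μ) (z.1 μ - w.1 μ) := by
    rw [ccoord_cast h1, hval, hval]
  exact_mod_cast h

/-- ★ **THE EXACT DICTIONARY**: for a label-faithful reading into the torus of the box periods (`Nf = N₀`), `d₁(ℓ z, ℓ w) = |chart⁻¹ z − chart⁻¹ w|₁` — the ℓ¹ torus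
STEP distance `Site.tdist` of the chart points (cast equality). [cite: Balaban1984PropagatorsII, (2.1) p.224, (2.46) p.231; Balaban1988RG2Cluster, (2.5) p.12, dictionary] -/
theorem tdist1_eq_tdist_chart_of_val (hNf : ∀ μ, (toKT i).NB μ = Nf μ)
    (hval : ∀ (z : SiteY i) (μ : Fin (d + 1)), (((UT.toSite Nf (ℓS z)) μ).val : ℤ) = z.1 μ) (z w : SiteY i) :
    tdist1 Nf (ℓS z) (ℓS w) = (Site.tdist ((boxEquiv i.hN).symm z) ((boxEquiv i.hN).symm w) : ℝ) := by
  rw [tdist1_eq_sum_circAbs_of_val i ℓS hval]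
  unfold Site.tdist
  push_cast
  refine Finset.sum_congr rfl fun μ _ => ?_
  have h := cast_min_val_chart_eq_circAbs i z w μ
  rw [hNf μ] at h
  exact_mod_cast h.symm

/-- ★ **THE LOWER COMPARISON** `|z − w|_T ≤ d₁(ℓ z, ℓ w)` (NODE 00's torus sup-distance is one of the summands). [cite: Balaban1984PropagatorsII, (2.46) p.231, bookkeeping] -/
theorem torusSupNorm_le_tdist1_of_val (hNf : ∀ μ, (toKT i).NB μ = Nf μ)
    (hval : ∀ (z : SiteY i) (μ : Fin (d + 1)), (((UT.toSite Nf (ℓS z)) μ).val : ℤ) = z.1 μ) (z w : SiteY i) :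
    torusSupNorm (toKT i).NB (z.1 - w.1) ≤ tdist1 Nf (ℓS z) (ℓS w) := by
  rw [tdist1_eq_sum_circAbs_of_val i ℓS hval]
  refine Finset.sup'_le _ _ fun μ _ => ?_
  have h0 : ∀ ν ∈ (Finset.univ : Finset (Fin (d + 1))), (0 : ℝ) ≤ ((circAbs (Nf ν) (z.1 ν - w.1 ν) : ℤ) : ℝ) := fun ν _ => by
    exact_mod_cast circAbs_nonneg NeZero.one_le _
  have h1 := Finset.single_le_sum h0 (Finset.mem_univ μ)
  rw [← hNf μ] at h1
  exact h1

end Dictionary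

/-! ## §2. The BLOCK reading that goes with a site reading: a block of `𝔅` read at its corner -/

section Blocks

variable {d ℓ : ℕ} {hd : 1 ≤ d + 1} {hL : Odd (ℓ + 1) ∧ 1 < ℓ + 1} {b₀ b₁ : ℝ}
variable (i : KIdx d ℓ hd hL b₀ b₁)
variable {Nf : Fin (d + 1) → ℕ} (ℓS : SiteY i → UT Nf)

/-- **THE BLOCK READING OF `𝔅` THAT GOES WITH A SITE READING `ℓ`**: a block `s` is read at its corner `blkCornerY s` (print: at the block's point `y`).
[cite: Balaban1988RG2Cluster, (2.5) p.12; Balaban1985BackgroundPropagators, (3.19) p.393; Balaban1984PropagatorsII, (2.45) p.231, dictionary] -/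
def blkReadingOf (s : BlkY i) : UT Nf := ℓS (blkCornerY i s)

/-- kernel: the corner determines the block, `blkOf (corner s) = s` (= `blkOf_corner`; public homonym `B9Ineq349SiteFromConv348.blkOf_blkCornerY`, not imported).
[folklore] -/
private theorem blkOf_blkCornerY (s : BlkY i) : blkOf i.D.toDomains (blkCornerY i s) = s := blkOf_corner i.D.toDomains s

/-- an injective site reading gives an injective block reading. [cite: Balaban1984PropagatorsII, (2.45) p.231, bookkeeping] -/
theorem blkReadingOf_injective (hinj : Function.Injective ℓS) : Function.Injective (blkReadingOf i ℓS) := by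
  intro s s' h
  have hc : blkCornerY i s = blkCornerY i s' := hinj h
  rw [← blkOf_blkCornerY i s, ← blkOf_blkCornerY i s', hc]

variable {κ : Type} [Fintype κ]

/-- ★ THE FIBRE BOUND `hfibB` of the stations: over each torus point sit at most `card κ` block coordinates `(s, k)`. [cite: Balaban1988RG2Cluster, (2.5) p.12, bookkeeping] -/
theorem card_fibre_blkReadingOf_le (hinj : Function.Injective ℓS) (y : UT Nf) :
    (univ.filter fun p : BlkY i × κ => blkReadingOf i ℓS p.1 = y).card ≤ Fintype.card κ := by
  rw [← Finset.card_univ (α := κ)]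
  refine Finset.card_le_card_of_injOn Prod.snd (fun p _ => by simp) ?_
  intro p hp q hq h
  have hp' := (Finset.mem_filter.1 (Finset.mem_coe.1 hp)).2
  have hq' := (Finset.mem_filter.1 (Finset.mem_coe.1 hq)).2
  exact Prod.ext (blkReadingOf_injective i ℓS hinj (hp'.trans hq'.symm)) h

variable [∀ μ, NeZero (Nf μ)]

/-- the block label through the chart: `blk_s z = ⌊val(x_μ)∕s⌋` for the chart point `x` of `z`. [cite: Balaban1984PropagatorsII, (2.1) p.224, bookkeeping] -/
theorem blk_eq_chart_div (s : ℕ) (z : SiteY i) (μ : Fin (d + 1)) :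
    blk s z.1 μ = (((((boxEquiv i.hN).symm z) μ).val / s : ℕ) : ℤ) := by
  rw [Int.natCast_div, val_boxEquiv_symm]
  rfl

/-- SAME BLOCK ⇒ CLOSE: `blk_s w = blk_s z`, `s ≥ 1` ⇒ `|chart⁻¹ z − chart⁻¹ w|₁ ≤ (d+1)(s − 1)`. [cite: Balaban1984PropagatorsII, (2.1) p.224 (blocks of side `L^j`), bookkeeping] -/
theorem tdist_chart_le_of_blk_eq {s : ℕ} (hs : 0 < s) {z w : SiteY i} (h : blk s w.1 = blk s z.1) :
    Site.tdist ((boxEquiv i.hN).symm z) ((boxEquiv i.hN).symm w) ≤ (d + 1) * (s - 1) := by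
  refine tdist_le_of_div_eq (P := PV d ℓ i.m i.K hd hL) hs fun μ => ?_
  have hμ := congrFun h μ
  rw [blk_eq_chart_div, blk_eq_chart_div] at hμ
  exact_mod_cast hμ.symm

/-- a site lies in the `L^{level}`-block of the corner of its block of `𝔅`: `blk_{L^j}(z) = blk_{L^j}(corner (blkOf z))`, `j` the block's level.
[cite: Balaban1984PropagatorsII, (2.45) p.231; Balaban1985BackgroundPropagators, (3.19) p.393, bookkeeping] -/
theorem blk_blkCornerY_eq {z : SiteY i} {s : BlkY i} (h : blkOf i.D.toDomains z = s) :
    blk ((ℓ + 1) ^ s.1.1) (blkCornerY i s).1 = blk ((ℓ + 1) ^ s.1.1) z.1 := by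
  rw [(blkOf_eq_iff_blk i.D.toDomains).1 (blkOf_blkCornerY i s), (blkOf_eq_iff_blk i.D.toDomains).1 h]

/-- the level of a block of `𝔅` is at most `k`. [cite: Balaban1984PropagatorsII, (2.1)–(2.4) p.224 («Ω_k»), dictionary] -/
theorem level_le (s : BlkY i) : s.1.1 ≤ i.k := by
  have h := blkOf_blkCornerY i s
  rw [← h]
  exact (toKT i).D.lev_le _

/-- THE CORNER LEG: for `z` in the block `s`, `|chart⁻¹(corner s) − chart⁻¹ z|₁ ≤ (d+1)(L^k − 1)`. [cite: Balaban1985BackgroundPropagators, (3.19) p.393; Balaban1984PropagatorsII, (2.45) p.231, bookkeeping] -/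
theorem tdist_chart_blkCornerY_le_of_blkOf_eq {z : SiteY i} {s : BlkY i} (h : blkOf i.D.toDomains z = s) :
    Site.tdist ((boxEquiv i.hN).symm (blkCornerY i s)) ((boxEquiv i.hN).symm z) ≤ (d + 1) * ((ℓ + 1) ^ i.k - 1) :=
  (tdist_chart_le_of_blk_eq i (Nat.pow_pos (Nat.succ_pos ℓ)) (blk_blkCornerY_eq i h).symm).trans
    (Nat.mul_le_mul_left _ (Nat.sub_le_sub_right (Nat.pow_le_pow_right (Nat.succ_pos ℓ) (level_le i s)) 1))

/-- ★ THE SITE ↔ BLOCK RANGE NUMERAL: for `z` in the block `s`, `d₁(ℓB s, ℓ z) ≤ (d+1)(L^k − 1)` (label-faithful `ℓ`, `Nf = N₀`).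
[cite: Balaban1988RG2Cluster, (2.5) p.12; Balaban1985BackgroundPropagators, (3.19) p.393] -/
theorem tdist1_blkReadingOf_le_of_blkOf_eq (hNf : ∀ μ, (toKT i).NB μ = Nf μ)
    (hval : ∀ (z : SiteY i) (μ : Fin (d + 1)), (((UT.toSite Nf (ℓS z)) μ).val : ℤ) = z.1 μ) {z : SiteY i} {s : BlkY i}
    (h : blkOf i.D.toDomains z = s) :
    tdist1 Nf (blkReadingOf i ℓS s) (ℓS z) ≤ ((d : ℝ) + 1) * ((((ℓ + 1) ^ i.k : ℕ) : ℝ) - 1) := by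
  unfold blkReadingOf
  rw [tdist1_eq_tdist_chart_of_val i ℓS hNf hval]
  have h1 := tdist_chart_blkCornerY_le_of_blkOf_eq i h
  have h2 : (1 : ℕ) ≤ (ℓ + 1) ^ i.k := Nat.one_le_pow _ _ (Nat.succ_pos ℓ)
  have h3 : ((Site.tdist ((boxEquiv i.hN).symm (blkCornerY i s)) ((boxEquiv i.hN).symm z) : ℕ) : ℝ) ≤
      (((d + 1) * ((ℓ + 1) ^ i.k - 1) : ℕ) : ℝ) := by exact_mod_cast h1
  refine h3.trans (le_of_eq ?_)
  rw [Nat.cast_mul, Nat.cast_sub h2]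
  push_cast
  ring

/-- kernel: NODE 00's `Q′` kernel links a block only to its own sites, `qpK s z ≠ 0 ⇒ blkOf z = s` (public homonym `B9Eq3104CutoffCommutatorSizes.qpK_ne_zero_imp`,
not imported to keep the closure light). [folklore] -/
private theorem blkOf_eq_of_qpK_ne_zero {s : BlkY i} {z : SiteY i} (h : qpK i s z ≠ 0) : blkOf i.D.toDomains z = s := by
  by_contra hne
  exact h (by rw [qpK, QM, if_neg hne])

/-- kernel: … and `Q′*`, `qpsK z s ≠ 0 ⇒ blkOf z = s` (public homonym `B9Eq3104CutoffCommutatorSizes.qpsK_ne_zero_imp`, not imported). [folklore] -/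
private theorem blkOf_eq_of_qpsK_ne_zero {z : SiteY i} {s : BlkY i} (h : qpsK i z s ≠ 0) : blkOf i.D.toDomains z = s := by
  by_contra hne
  exact h (by rw [qpsK, QsM, if_neg hne])

/-- ★★ **XQuadGen ∕ RProj's RANGE BINDER `hℓQ` AS A NUMBER**: `qpK s z ≠ 0 ⇒ d₁(ℓB s, ℓ z) ≤ (d+1)(L^k − 1)`.
[cite: Balaban1988RG2Cluster, (2.5) p.12, p.15; Balaban1984PropagatorsII, (2.14)–(2.16) p.225; Balaban1985BackgroundPropagators, (3.108) p.416] -/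
theorem hℓQ_blkReadingOf (hNf : ∀ μ, (toKT i).NB μ = Nf μ)
    (hval : ∀ (z : SiteY i) (μ : Fin (d + 1)), (((UT.toSite Nf (ℓS z)) μ).val : ℤ) = z.1 μ) :
    ∀ (s : BlkY i) (z : SiteY i), qpK i s z ≠ 0 → tdist1 Nf (blkReadingOf i ℓS s) (ℓS z) ≤ ((d : ℝ) + 1) * ((((ℓ + 1) ^ i.k : ℕ) : ℝ) - 1) :=
  fun _ _ h => tdist1_blkReadingOf_le_of_blkOf_eq i ℓS hNf hval (blkOf_eq_of_qpK_ne_zero i h)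

/-- ★★ **… AND `hℓQs`**: `qpsK z s ≠ 0 ⇒ d₁(ℓ z, ℓB s) ≤ (d+1)(L^k − 1)`. [cite: Balaban1988RG2Cluster, (2.5) p.12; Balaban1984PropagatorsII, (2.17) p.225, (2.69) p.235] -/
theorem hℓQs_blkReadingOf (hNf : ∀ μ, (toKT i).NB μ = Nf μ)
    (hval : ∀ (z : SiteY i) (μ : Fin (d + 1)), (((UT.toSite Nf (ℓS z)) μ).val : ℤ) = z.1 μ) :
    ∀ (z : SiteY i) (s : BlkY i), qpsK i z s ≠ 0 → tdist1 Nf (ℓS z) (blkReadingOf i ℓS s) ≤ ((d : ℝ) + 1) * ((((ℓ + 1) ^ i.k : ℕ) : ℝ) - 1) :=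
  fun _ _ h => by
    rw [tdist1_comm]
    exact tdist1_blkReadingOf_le_of_blkOf_eq i ℓS hNf hval (blkOf_eq_of_qpsK_ne_zero i h)

end Blocks

/-! ## §3. The FINE-BOND reading that goes with a site reading: a bond read at its source -/

section Bonds

variable {d ℓ : ℕ} {hd : 1 ≤ d + 1} {hL : Odd (ℓ + 1) ∧ 1 < ℓ + 1} {b₀ b₁ : ℝ}
variable (i : KIdx d ℓ hd hL b₀ b₁)
variable {Nf : Fin (d + 1) → ℕ} (ℓS : SiteY i → UT Nf)

/-- **THE FINE-BOND READING THAT GOES WITH A SITE READING `ℓ`**: a bond `b = ⟨x, x + e_μ⟩` is read at its source `b₋ = x` (its chart point).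
[cite: Balaban1988RG2Cluster, (2.5) p.12; Balaban1985BackgroundPropagators, (3.3) p.390; Balaban1985Averaging, (5) p.18, dictionary] -/
def bondReadingOf (b : FBondY i) : UT Nf := ℓS (boxEquiv i.hN b.src)

variable {κ : Type} [Fintype κ]

/-- ★ THE FIBRE BOUND `hfibF`: over each torus point sit at most `(d+1)·card κ` bond coordinates `(b, k)` (the `d+1` bonds out of one source).
[cite: Balaban1988RG2Cluster, (2.5) p.12; Balaban1985Averaging, (5) p.18, bookkeeping] -/
theorem card_fibre_bondReadingOf_le (hinj : Function.Injective ℓS) (y : UT Nf) :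
    (univ.filter fun p : FBondY i × κ => bondReadingOf i ℓS p.1 = y).card ≤ (d + 1) * Fintype.card κ := by
  have hc : (Finset.univ : Finset (Fin (d + 1) × κ)).card = (d + 1) * Fintype.card κ := by
    rw [Finset.card_univ, Fintype.card_prod, Fintype.card_fin]
  rw [← hc]
  refine Finset.card_le_card_of_injOn (fun p : FBondY i × κ => (p.1.dir, p.2)) (fun p _ => by simp) ?_
  rintro ⟨⟨sr, dr⟩, k⟩ hp ⟨⟨sr', dr'⟩, k'⟩ hq h
  have hp' := (Finset.mem_filter.1 (Finset.mem_coe.1 hp)).2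
  have hq' := (Finset.mem_filter.1 (Finset.mem_coe.1 hq)).2
  simp only [Prod.mk.injEq] at h
  obtain ⟨rfl, rfl⟩ := h
  have hsrc : sr = sr' := (boxEquiv i.hN).injective (hinj (hp'.trans hq'.symm))
  subst hsrc
  rfl

variable [∀ μ, NeZero (Nf μ)]

/-- a bond's source is read AT the bond: `d₁(ℓF b, ℓ(chart b₋)) = 0`. [cite: Balaban1985BackgroundPropagators, (3.3) p.390, bookkeeping] -/
theorem tdist1_bondReadingOf_src (b : FBondY i) : tdist1 Nf (bondReadingOf i ℓS b) (ℓS (boxEquiv i.hN b.src)) = 0 :=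
  tdist1_self _

/-- a bond's target is one step from its reading: `d₁(ℓF b, ℓ(chart b₊)) ≤ 1` (label-faithful `ℓ`, `Nf = N₀`). [cite: Balaban1985BackgroundPropagators, (3.3) p.390; Balaban1988RG2Cluster, (2.5) p.12] -/
theorem tdist1_bondReadingOf_tgt_le_one (hNf : ∀ μ, (toKT i).NB μ = Nf μ)
    (hval : ∀ (z : SiteY i) (μ : Fin (d + 1)), (((UT.toSite Nf (ℓS z)) μ).val : ℤ) = z.1 μ) (b : FBondY i) :
    tdist1 Nf (bondReadingOf i ℓS b) (ℓS (boxEquiv i.hN b.tgt)) ≤ 1 := by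
  unfold bondReadingOf
  rw [tdist1_eq_tdist_chart_of_val i ℓS hNf hval, Equiv.symm_apply_apply, Equiv.symm_apply_apply]
  exact_mod_cast tdist_shift_le_one b.src b.dir

/-- ★★ **GREEN's RANGE BINDER `hℓG` AS A NUMBER**: a non-zero gradient entry `∂(b, z)` forces `z ∈ {chart b₊, chart b₋}`, so `d₁(ℓF b, ℓ z) ≤ 1`.
[cite: Balaban1985BackgroundPropagators, (3.3) p.390, (3.108) p.416; Balaban1988RG2Cluster, (2.5) p.12] -/
theorem hℓG_bondReadingOf (hNf : ∀ μ, (toKT i).NB μ = Nf μ)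
    (hval : ∀ (z : SiteY i) (μ : Fin (d + 1)), (((UT.toSite Nf (ℓS z)) μ).val : ℤ) = z.1 μ) :
    ∀ (b : FBondY i) (z : SiteY i), gradK i b z ≠ 0 → tdist1 Nf (bondReadingOf i ℓS b) (ℓS z) ≤ 1 := by
  intro b z h
  rcases gradK_ne_zero_cases i h with h1 | h1
  · rw [h1]; exact tdist1_bondReadingOf_tgt_le_one i ℓS hNf hval b
  · rw [h1, tdist1_bondReadingOf_src]; exact zero_le_one

/-- ★★ **… AND `hℓD`** (the divergence is the transposed stencil): `∂*(z, b) ≠ 0 ⇒ d₁(ℓ z, ℓF b) ≤ 1`. [cite: Balaban1985BackgroundPropagators, (3.8) p.392, (3.108) p.416; Balaban1988RG2Cluster, (2.5) p.12] -/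
theorem hℓD_bondReadingOf (hNf : ∀ μ, (toKT i).NB μ = Nf μ)
    (hval : ∀ (z : SiteY i) (μ : Fin (d + 1)), (((UT.toSite Nf (ℓS z)) μ).val : ℤ) = z.1 μ) :
    ∀ (z : SiteY i) (b : FBondY i), divK i z b ≠ 0 → tdist1 Nf (ℓS z) (bondReadingOf i ℓS b) ≤ 1 := by
  intro z b h
  rw [tdist1_comm]
  refine hℓG_bondReadingOf i ℓS hNf hval b z ?_
  rwa [divK_eq_transpose, Matrix.transpose_apply] at h

/-- the sources of the four contour bonds of a plaquette `⟨x, x+e_μ, x+e_μ+e_ν, x+e_ν⟩` are `x + e_ν, x, x, x + e_μ`: each within ONE step of `x`.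
[cite: Balaban1985BackgroundPropagators, (3.2) p.390, bookkeeping] -/
theorem tdist_src_edgeY_src_le_one (p : Node00.PlaqY i) (m : Fin 4) : Site.tdist p.src (edgeY i p m).src ≤ 1 := by
  fin_cases m
  · exact tdist_shift_le_one p.src p.ν
  · show Site.tdist p.src p.src ≤ 1
    unfold Site.tdist; simp
  · show Site.tdist p.src p.src ≤ 1
    unfold Site.tdist; simp
  · exact tdist_shift_le_one p.src p.μ

/-- ★ **MODULE 76's PLAQUETTE-DIAMETER BINDER `hℓp` AS A NUMBER**: two contour bonds of one plaquette read within `d₁ ≤ 2` (through the chart point of the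
plaquette's corner `x`). [cite: Balaban1985BackgroundPropagators, (3.2) p.390, (3.10) p.392, (3.108) p.416; Balaban1988RG2Cluster, (2.5) p.12] -/
theorem hℓp_bondReadingOf (hNf : ∀ μ, (toKT i).NB μ = Nf μ)
    (hval : ∀ (z : SiteY i) (μ : Fin (d + 1)), (((UT.toSite Nf (ℓS z)) μ).val : ℤ) = z.1 μ) :
    ∀ (p : Node00.PlaqY i) (m l : Fin 4), tdist1 Nf (bondReadingOf i ℓS (edgeY i p m)) (bondReadingOf i ℓS (edgeY i p l)) ≤ 2 := by
  intro p m l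
  have hleg : ∀ n : Fin 4, tdist1 Nf (bondReadingOf i ℓS (edgeY i p n)) (ℓS (boxEquiv i.hN p.src)) ≤ 1 := by
    intro n
    unfold bondReadingOf
    rw [tdist1_eq_tdist_chart_of_val i ℓS hNf hval, Equiv.symm_apply_apply, Equiv.symm_apply_apply, tdist_comm']
    exact_mod_cast tdist_src_edgeY_src_le_one i p n
  calc tdist1 Nf (bondReadingOf i ℓS (edgeY i p m)) (bondReadingOf i ℓS (edgeY i p l))
      ≤ tdist1 Nf (bondReadingOf i ℓS (edgeY i p m)) (ℓS (boxEquiv i.hN p.src)) +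
          tdist1 Nf (ℓS (boxEquiv i.hN p.src)) (bondReadingOf i ℓS (edgeY i p l)) := tdist1_triangle _ _ _
    _ ≤ 1 + 1 := add_le_add (hleg m) (by rw [tdist1_comm]; exact hleg l)
    _ = 2 := by norm_num

end Bonds


/-! ## §4. ★ The instances at dag-n10-w6's fine reading `fineReadingY` (`B13SiteReadingNumerals`, p611691): the block ∕ bond readings of record for
these located instances and every station binder as a number -/

section Fine

open Literature.MathematicalPhysics.QuantumFieldTheory.Balaban1983to89.B13SiteReadingNumerals (fineReadingY fineReadingY_val fineReadingY_injective)

variable {d ℓ : ℕ} {hd : 1 ≤ d + 1} {hL : Odd (ℓ + 1) ∧ 1 < ℓ + 1} {b₀ b₁ : ℝ}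
variable (i : KIdx d ℓ hd hL b₀ b₁) {Nf : Fin (d + 1) → ℕ}

/-- **THE BLOCK READING OF `𝔅` OF RECORD FOR THESE INSTANCES**: dag-n10-w6's fine reading of the block's corner (`ℓB := fineReadingY ∘ blkCornerY`).
[cite: Balaban1988RG2Cluster, (2.5) p.12; Balaban1985BackgroundPropagators, (3.19) p.393; Balaban1984PropagatorsII, (2.45) p.231, dictionary] -/
def blkReadingY (hNf : ∀ μ, (toKT i).NB μ = Nf μ) : BlkY i → UT Nf := blkReadingOf i (fineReadingY i hNf)

/-- **THE FINE-BOND READING OF RECORD FOR THESE INSTANCES**: dag-n10-w6's fine reading of the bond's source (`ℓF := fineReadingY ∘ chart ∘ src`).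
[cite: Balaban1988RG2Cluster, (2.5) p.12; Balaban1985BackgroundPropagators, (3.3) p.390, dictionary] -/
def bondReadingY (hNf : ∀ μ, (toKT i).NB μ = Nf μ) : FBondY i → UT Nf := bondReadingOf i (fineReadingY i hNf)

/-- `ℓB s = ℓ_fine (corner s)`. [cite: Balaban1985BackgroundPropagators, (3.19) p.393, bookkeeping] -/
theorem blkReadingY_apply (hNf : ∀ μ, (toKT i).NB μ = Nf μ) (s : BlkY i) : blkReadingY i hNf s = fineReadingY i hNf (blkCornerY i s) := rfl

/-- `ℓF b = ℓ_fine (chart b₋)`. [cite: Balaban1985BackgroundPropagators, (3.3) p.390, bookkeeping] -/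
theorem bondReadingY_apply (hNf : ∀ μ, (toKT i).NB μ = Nf μ) (b : FBondY i) : bondReadingY i hNf b = fineReadingY i hNf (boxEquiv i.hN b.src) := rfl

/-- the block reading is injective. [cite: Balaban1984PropagatorsII, (2.45) p.231, bookkeeping] -/
theorem blkReadingY_injective (hNf : ∀ μ, (toKT i).NB μ = Nf μ) : Function.Injective (blkReadingY i hNf) :=
  blkReadingOf_injective i _ (fineReadingY_injective i hNf)

variable {κ : Type} [Fintype κ]

/-- ★ **XQuadGen ∕ RProj's `hfibB` AT THE READING OF RECORD: `mB = card κ`.** [cite: Balaban1988RG2Cluster, (2.5) p.12; Balaban1985BackgroundPropagators, (3.107)–(3.108) p.416 (multiplicities), bookkeeping] -/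
theorem card_fibre_blkReadingY_le (hNf : ∀ μ, (toKT i).NB μ = Nf μ) (y : UT Nf) :
    (univ.filter fun p : BlkY i × κ => blkReadingY i hNf p.1 = y).card ≤ Fintype.card κ :=
  card_fibre_blkReadingOf_le i _ (fineReadingY_injective i hNf) y

/-- ★ **Green ∕ DeltaALetters' `hfibF` AT THE READING OF RECORD: `mF = (d+1)·card κ`.** [cite: Balaban1988RG2Cluster, (2.5) p.12; Balaban1985Averaging, (5) p.18, bookkeeping] -/
theorem card_fibre_bondReadingY_le (hNf : ∀ μ, (toKT i).NB μ = Nf μ) (y : UT Nf) :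
    (univ.filter fun p : FBondY i × κ => bondReadingY i hNf p.1 = y).card ≤ (d + 1) * Fintype.card κ :=
  card_fibre_bondReadingOf_le i _ (fineReadingY_injective i hNf) y

/-- `hfibB` at matrix units (`κ = Fin N × Fin N`): `mB = N·N`. [cite: Balaban1985BackgroundPropagators, (3.107)–(3.108) p.416, bookkeeping] -/
theorem card_fibre_blkReadingY_matrixUnits {N : ℕ} (hNf : ∀ μ, (toKT i).NB μ = Nf μ) (y : UT Nf) :
    (univ.filter fun p : BlkY i × (Fin N × Fin N) => blkReadingY i hNf p.1 = y).card ≤ N * N :=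
  (card_fibre_blkReadingY_le i hNf y).trans (by rw [Fintype.card_prod, Fintype.card_fin])

/-- `hfibF` at matrix units: `mF = (d+1)·(N·N)`. [cite: Balaban1985BackgroundPropagators, (3.107)–(3.108) p.416, bookkeeping] -/
theorem card_fibre_bondReadingY_matrixUnits {N : ℕ} (hNf : ∀ μ, (toKT i).NB μ = Nf μ) (y : UT Nf) :
    (univ.filter fun p : FBondY i × (Fin N × Fin N) => bondReadingY i hNf p.1 = y).card ≤ (d + 1) * (N * N) :=
  (card_fibre_bondReadingY_le i hNf y).trans (by rw [Fintype.card_prod, Fintype.card_fin])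

variable [∀ μ, NeZero (Nf μ)]

/-- ★ **THE EXACT DICTIONARY AT THE FINE READING**: `d₁(ℓ_fine z, ℓ_fine w) = |chart⁻¹ z − chart⁻¹ w|₁` (cast equality; dag-n10-w6's `tdist1_fineReadingY_eq` gives the
`Σ_μ dist(z_μ − w_μ, N_μℤ)` form and `tdist_boxEquiv_symm_le` the one-sided `≤ Σ_μ |z_μ − w_μ|`). [cite: Balaban1984PropagatorsII, (2.1) p.224, (2.46) p.231; Balaban1988RG2Cluster, (2.5) p.12, dictionary] -/
theorem tdist1_fineReadingY_eq_tdist_chart (hNf : ∀ μ, (toKT i).NB μ = Nf μ) (z w : SiteY i) :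
    tdist1 Nf (fineReadingY i hNf z) (fineReadingY i hNf w) = (Site.tdist ((boxEquiv i.hN).symm z) ((boxEquiv i.hN).symm w) : ℝ) :=
  tdist1_eq_tdist_chart_of_val i _ hNf (fineReadingY_val i hNf) z w

/-- ★ **THE LOWER COMPARISON AT THE FINE READING**: `|z − w|_T ≤ d₁(ℓ_fine z, ℓ_fine w)` — with dag-n10-w6's `tdist1_fineReadingY_le_mul_torusSupNorm` the fine reading
is bi-Lipschitz to NODE 00's torus norm with constants `1` and `d+1`. [cite: Balaban1984PropagatorsII, (2.46) p.231; Balaban1985BackgroundPropagators, (3.108) p.416, bookkeeping] -/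
theorem torusSupNorm_le_tdist1_fineReadingY (hNf : ∀ μ, (toKT i).NB μ = Nf μ) (z w : SiteY i) :
    torusSupNorm (toKT i).NB (z.1 - w.1) ≤ tdist1 Nf (fineReadingY i hNf z) (fineReadingY i hNf w) :=
  torusSupNorm_le_tdist1_of_val i _ hNf (fineReadingY_val i hNf) z w

/-- the site ↔ block range numeral at the readings of record: `z ∈ s ⇒ d₁(ℓB s, ℓ_fine z) ≤ (d+1)(L^k − 1)`. [cite: Balaban1988RG2Cluster, (2.5) p.12; Balaban1985BackgroundPropagators, (3.19) p.393] -/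
theorem tdist1_blkReadingY_le_of_blkOf_eq (hNf : ∀ μ, (toKT i).NB μ = Nf μ) {z : SiteY i} {s : BlkY i} (h : blkOf i.D.toDomains z = s) :
    tdist1 Nf (blkReadingY i hNf s) (fineReadingY i hNf z) ≤ ((d : ℝ) + 1) * ((((ℓ + 1) ^ i.k : ℕ) : ℝ) - 1) :=
  tdist1_blkReadingOf_le_of_blkOf_eq i _ hNf (fineReadingY_val i hNf) h

/-- ★★ **XQuadGen ∕ RProj's `hℓQ` AT THE READINGS OF RECORD with `r = (d+1)(L^k − 1)`.** [cite: Balaban1988RG2Cluster, (2.5) p.12, p.15; Balaban1984PropagatorsII, (2.14)–(2.16) p.225; Balaban1985BackgroundPropagators, (3.108) p.416] -/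
theorem hℓQ_blkReadingY (hNf : ∀ μ, (toKT i).NB μ = Nf μ) :
    ∀ (s : BlkY i) (z : SiteY i), qpK i s z ≠ 0 → tdist1 Nf (blkReadingY i hNf s) (fineReadingY i hNf z) ≤ ((d : ℝ) + 1) * ((((ℓ + 1) ^ i.k : ℕ) : ℝ) - 1) :=
  hℓQ_blkReadingOf i _ hNf (fineReadingY_val i hNf)

/-- ★★ **… and `hℓQs`.** [cite: Balaban1988RG2Cluster, (2.5) p.12; Balaban1984PropagatorsII, (2.17) p.225, (2.69) p.235] -/
theorem hℓQs_blkReadingY (hNf : ∀ μ, (toKT i).NB μ = Nf μ) :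
    ∀ (z : SiteY i) (s : BlkY i), qpsK i z s ≠ 0 → tdist1 Nf (fineReadingY i hNf z) (blkReadingY i hNf s) ≤ ((d : ℝ) + 1) * ((((ℓ + 1) ^ i.k : ℕ) : ℝ) - 1) :=
  hℓQs_blkReadingOf i _ hNf (fineReadingY_val i hNf)

/-- the bond steps at the readings of record: `d₁(ℓF b, ℓ_fine(chart b₋)) = 0`. [cite: Balaban1985BackgroundPropagators, (3.3) p.390, bookkeeping] -/
theorem tdist1_bondReadingY_src (hNf : ∀ μ, (toKT i).NB μ = Nf μ) (b : FBondY i) :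
    tdist1 Nf (bondReadingY i hNf b) (fineReadingY i hNf (boxEquiv i.hN b.src)) = 0 :=
  tdist1_bondReadingOf_src i _ b

/-- … and `d₁(ℓF b, ℓ_fine(chart b₊)) ≤ 1`. [cite: Balaban1985BackgroundPropagators, (3.3) p.390; Balaban1988RG2Cluster, (2.5) p.12] -/
theorem tdist1_bondReadingY_tgt_le_one (hNf : ∀ μ, (toKT i).NB μ = Nf μ) (b : FBondY i) :
    tdist1 Nf (bondReadingY i hNf b) (fineReadingY i hNf (boxEquiv i.hN b.tgt)) ≤ 1 :=
  tdist1_bondReadingOf_tgt_le_one i _ hNf (fineReadingY_val i hNf) b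

/-- ★★ **Green's `hℓG` AT THE READINGS OF RECORD with `r′ = 1`.** [cite: Balaban1985BackgroundPropagators, (3.3) p.390, (3.108) p.416; Balaban1988RG2Cluster, (2.5) p.12] -/
theorem hℓG_bondReadingY (hNf : ∀ μ, (toKT i).NB μ = Nf μ) :
    ∀ (b : FBondY i) (z : SiteY i), gradK i b z ≠ 0 → tdist1 Nf (bondReadingY i hNf b) (fineReadingY i hNf z) ≤ 1 :=
  hℓG_bondReadingOf i _ hNf (fineReadingY_val i hNf)

/-- ★★ **… and `hℓD`.** [cite: Balaban1985BackgroundPropagators, (3.8) p.392, (3.108) p.416; Balaban1988RG2Cluster, (2.5) p.12] -/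
theorem hℓD_bondReadingY (hNf : ∀ μ, (toKT i).NB μ = Nf μ) :
    ∀ (z : SiteY i) (b : FBondY i), divK i z b ≠ 0 → tdist1 Nf (fineReadingY i hNf z) (bondReadingY i hNf b) ≤ 1 :=
  hℓD_bondReadingOf i _ hNf (fineReadingY_val i hNf)

/-- ★ **module 76's plaquette-diameter `hℓp` AT THE READING OF RECORD with `2`.** [cite: Balaban1985BackgroundPropagators, (3.2) p.390, (3.10) p.392; Balaban1988RG2Cluster, (2.5) p.12] -/
theorem hℓp_bondReadingY (hNf : ∀ μ, (toKT i).NB μ = Nf μ) :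
    ∀ (p : Node00.PlaqY i) (m l : Fin 4), tdist1 Nf (bondReadingY i hNf (edgeY i p m)) (bondReadingY i hNf (edgeY i p l)) ≤ 2 :=
  hℓp_bondReadingOf i _ hNf (fineReadingY_val i hNf)

end Fine

end Literature.MathematicalPhysics.QuantumFieldTheory.Balaban1983to89.B13BlockBondReadingNumerals

end
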